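import Summits.BirchSwinnertonDyer.BirchSwinnertonDyer.Theses.ResidualThetaTransportAtTwo
import Summits.BirchSwinnertonDyer.BirchSwinnertonDyer.Theorems.ResidualThetaTransportAtTwoSignedMuVanishingAtTwoPlusCuspSpanNamed
import Summits.BirchSwinnertonDyer.BirchSwinnertonDyer.Theorems.ResidualThetaTransportAtTwoSignedMuVanishingAtTwoPlusLineV42
import HarnessLib

/-!
# Crux Kμ⁺ `SignedMuVanishingAtTwoPlus` (stmt-BirchSwinnertonDyer-20689), line `birth` v4.6: the crux BY NAME from its
# ledger cone {21438, 27435, 27436}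

Cell `bsd-wall`, lead `bsd-wall-rtt-p4` g7 (helper, `--supports stmt-BirchSwinnertonDyer-20689`; THEOREMS ONLY — no `def`, no
named fact, no `sorry`). BSD is not proved by this; every hypothesis below is an OPEN ledger item or a print fact taken by name.

Since route rev 33 (W8′, pen bsd-wall-p2 g16) the curve-free analytic node of this line is a ROUTE ITEM: `CuspSpanEvenAtTwoOdd`
(stmt-BirchSwinnertonDyer-27436, shared with Kan⁺ 20688 and TP2 K1; definitionally «`SignedMuAtTwo.CuspSpanEvenAtTwo N` for every
odd `N`»), and Abbes–Ullmo Thm A is the fifth conjunct of the PUB⁵ bundle item `PublishedInputsHeckeAtTwo`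
(stmt-BirchSwinnertonDyer-27435). This file keys the landed closers of line `birth` (`…CuspSpanNamed`, p596171; `…LineV42`,
p585569) to those route declarations:

* `flatMuZeroAtTwo_of_cuspSpanEvenAtTwoOdd` — the registered stub `FlatMuZeroAtTwo` (verbatim) from item 27436;
* `signedMuAnalyticAtTwoPlus_of_abbesUllmo_of_cuspSpanEvenAtTwoOdd`, `signedMuAnalyticAtTwoPlus_of_pub_of_cuspSpanEvenAtTwoOdd` —
  the analytic child 21437 from {Abbes–Ullmo | item 27435} ∧ item 27436;
* `signedMuVanishingAtTwoPlus_of_seed_of_abbesUllmo_of_cuspSpanEvenAtTwoOdd`, `signedMuVanishingAtTwoPlus_of_seed_of_pub_of_cuspSpanEvenAtTwoOdd`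
  — the crux from {item 21438, Abbes–Ullmo | item 27435, item 27436};
* `signedMuVanishingAtTwoPlus_iff_seed_of_pub_of_cuspSpanEvenAtTwoOdd` — granted the two sibling items 27435 and 27436, the crux
  IS the μ-seed item 21438 (`signedMuVanishingAtTwoPlus_iff_analytic_and_seed`).

So the ledger cone of Kμ⁺ along line `birth` is exactly {21438 (conjecture-grade μ-seed), 27435 (print bundle), 27436 (node,
open ∀ odd N; kit-verified for all odd N ≤ 2999 and the habitat⁺ census conductors)}. References: R. Pollack, Duke Math. J. 118
(2003) Conj. 6.3, Prop. 6.18 [Pollack2003]; A. Abbes, E. Ullmo, Compositio Math. 103 (1996) Thm. A [AbbesUllmo1996]; R. Greenberg,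
LNM 1716 (1999) Conj. 1.11 [Greenberg1999LNM].
-/

set_option autoImplicit false
-- justification: the `Summit.BirchSwinnertonDyer.BirchSwinnertonDyer.…` path repeats a component (route-file convention)
set_option linter.dupNamespace false

noncomputable section

open scoped Classical MatrixGroups ModularForm

open CongruenceSubgroup WeierstrassCurve Literature.NumberTheory.EllipticCurves
  Literature.NumberTheory.EllipticCurves.ModularForms Literature.NumberTheory.EllipticCurves.Rank1Residual
  Literature.NumberTheory.IwasawaTheory Summit.BirchSwinnertonDyer.Rank1Residual.Supersingular
  Summit.BirchSwinnertonDyer.BirchSwinnertonDyer.Theses.ResidualThetaTransportAtTwo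

namespace Summit.BirchSwinnertonDyer.BirchSwinnertonDyer.Theorems.SignedMuAtTwo

/-- **The route's node item 27436 `CuspSpanEvenAtTwoOdd` ⟹ the registered stub `FlatMuZeroAtTwo`** of line `birth` (verbatim:
on the habitat⁺, `2 ∤ L♭` for every Pollack pair at `2` of the newform of `W`). The node is `CuspSpanEvenAtTwo N` at every odd
`N` by `rfl`. BSD is not proved by this; the node is open. [cite: Pollack2003, Conj. 6.3 and Prop. 6.18] -/
theorem flatMuZeroAtTwo_of_cuspSpanEvenAtTwoOdd (hNode : CuspSpanEvenAtTwoOdd) :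
    ∀ (W : WeierstrassCurve ℚ) [W.IsElliptic] [W.IsGloballyMinimal], ¬ W.HasCM → W.analyticRank = 0 →
      GoodSS W 2 → W.frobeniusTrace 2 = 0 → W.Δ < 0 →
      ∀ [NeZero (W.conductorNorm ℤ)] (f : CuspForm (Gamma0 (W.conductorNorm ℤ)) 2), IsNewformOf W f →
      ∀ (Lplus Lminus : IwasawaAlgebra 2), IsPollackPair f 2 Lplus Lminus → ¬ PowerSeries.C (2 : ℤ_[2]) ∣ Lminus :=
  flatMuZeroAtTwo_of_forall_cuspSpanEvenAtTwo fun N _ hN ↦ hNode N hN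

/-- **Abbes–Ullmo Thm A (by name) ∧ node item 27436 ⟹ the analytic child 21437 `SignedMuAnalyticAtTwoPlus`.** Conditional on the
print fact and the open node; BSD is not proved by this. [cite: AbbesUllmo1996, Thm. A] [cite: Pollack2003, Conj. 6.3 and Prop. 6.18] -/
theorem signedMuAnalyticAtTwoPlus_of_abbesUllmo_of_cuspSpanEvenAtTwoOdd
    (hAU : abbesUllmo_not_dvd_maninConstant_of_not_dvd_level) (hNode : CuspSpanEvenAtTwoOdd) : SignedMuAnalyticAtTwoPlus :=
  signedMuAnalyticAtTwoPlus_of_abbesUllmo_of_forall_cuspSpanEvenAtTwo hAU fun N _ hN ↦ hNode N hN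

/-- **PUB⁵ bundle item 27435 ∧ node item 27436 ⟹ the analytic child 21437** — only the fifth conjunct (Abbes–Ullmo Thm A) of
`PublishedInputsHeckeAtTwo` is used. BSD is not proved by this. [cite: AbbesUllmo1996, Thm. A] -/
theorem signedMuAnalyticAtTwoPlus_of_pub_of_cuspSpanEvenAtTwoOdd (hPub : PublishedInputsHeckeAtTwo)
    (hNode : CuspSpanEvenAtTwoOdd) : SignedMuAnalyticAtTwoPlus :=
  signedMuAnalyticAtTwoPlus_of_abbesUllmo_of_cuspSpanEvenAtTwoOdd hPub.2.2.2.2 hNode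

/-- **The crux Kμ⁺ BY NAME from {seed item 21438, Abbes–Ullmo Thm A (print), node item 27436}**: the seed closes the algebraic
half through the proved propagation at `2` (`signedMuVanishingAtTwoPlus_of_analytic_of_seed`, p585569), the node and the period fact
close the analytic half. Conditional on two open items and one print fact; BSD is not proved by this.
[cite: Greenberg1999LNM, Conj. 1.11] [cite: AbbesUllmo1996, Thm. A] [cite: Pollack2003, Conj. 6.3 and Prop. 6.18] -/
theorem signedMuVanishingAtTwoPlus_of_seed_of_abbesUllmo_of_cuspSpanEvenAtTwoOdd (hSeed : SignedMuSeedAtTwoPlus)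
    (hAU : abbesUllmo_not_dvd_maninConstant_of_not_dvd_level) (hNode : CuspSpanEvenAtTwoOdd) : SignedMuVanishingAtTwoPlus :=
  signedMuVanishingAtTwoPlus_of_analytic_of_seed (signedMuAnalyticAtTwoPlus_of_abbesUllmo_of_cuspSpanEvenAtTwoOdd hAU hNode) hSeed

/-- **The crux Kμ⁺ BY NAME from THREE ROUTE ITEMS** {21438 `SignedMuSeedAtTwoPlus`, 27435 `PublishedInputsHeckeAtTwo`, 27436
`CuspSpanEvenAtTwoOdd`} — the complete ledger cone of line `birth`. BSD is not proved by this.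
[cite: Greenberg1999LNM, Conj. 1.11] [cite: AbbesUllmo1996, Thm. A] -/
theorem signedMuVanishingAtTwoPlus_of_seed_of_pub_of_cuspSpanEvenAtTwoOdd (hSeed : SignedMuSeedAtTwoPlus)
    (hPub : PublishedInputsHeckeAtTwo) (hNode : CuspSpanEvenAtTwoOdd) : SignedMuVanishingAtTwoPlus :=
  signedMuVanishingAtTwoPlus_of_analytic_of_seed (signedMuAnalyticAtTwoPlus_of_pub_of_cuspSpanEvenAtTwoOdd hPub hNode) hSeed

/-- **Granted the sibling items 27435 (PUB⁵) and 27436 (node), the crux Kμ⁺ IS the μ-seed item 21438** (kernel-exact: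
`signedMuVanishingAtTwoPlus_iff_analytic_and_seed`). BSD is not proved by this. [cite: Greenberg1999LNM, Conj. 1.11] -/
theorem signedMuVanishingAtTwoPlus_iff_seed_of_pub_of_cuspSpanEvenAtTwoOdd (hPub : PublishedInputsHeckeAtTwo)
    (hNode : CuspSpanEvenAtTwoOdd) : SignedMuVanishingAtTwoPlus ↔ SignedMuSeedAtTwoPlus :=
  ⟨fun h ↦ (signedMuVanishingAtTwoPlus_iff_analytic_and_seed.mp h).2,
    fun hSeed ↦ signedMuVanishingAtTwoPlus_of_seed_of_pub_of_cuspSpanEvenAtTwoOdd hSeed hPub hNode⟩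

end Summit.BirchSwinnertonDyer.BirchSwinnertonDyer.Theorems.SignedMuAtTwo

end
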